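import Summits.QuantumFields.YangMills.Theorems.BalabanUVNodesN20HybridClassLawCharacterisation

/-!
# BalabanUVNodes ∕ N20·N19′·N21 — LAW SEPARATION FROM TWO MOMENTS OF ANY CLASS STATISTIC (FILE N; NO caricature, NO independence): if, infinitely often in `K`, some real statistic `f`
# of the keyed classes has two-run centres `m_A ≠ m_B` with `(m_B − m_A)² ≥ 8·(V_A + V_B)` (normalised squared spreads about the centres), then NO `(Bad, W, shA, shB, Wsh, δ)` gives
# node U5's `HybridNE7` — Chebyshev on the class set `{f ≥ (m_A+m_B)∕2}` against dag-n20-w4's summable class-law TV radius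

Cell `pub-ymgap` (HUMAN RULING D-0062 Track A; work-bound push D-0149, director-ym №197), width seat `pub-ymgap-dag-n20-w1` (gen 6) on node N20 = NE7b; key item K3⁸
`SpineGivenEndpointR13SepCoPHV` = stmt-QuantumFields-27366 (dag-lead KEY MAP v2, INBOX l.35754: `--kind proof --supports 27366 --as helper`; lineage key K3⁷ stmt-QuantumFields-20544 aside);
COUNT-NEUTRAL.  Bus: CLAIM-18 ∕ INTENT-23.  THEOREMS ONLY: no `def`, no `instance`, no `notation`, no `sorry`; imports dag-n20-w4's `…N20HybridClassLawCharacterisation` (p609004: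
`exists_tvRadius_of_hybridNE7`) ONLY.

WHY.  MY caricature series (FILES A–M) located the mechanism that kills stub 2's face triple at a saturated key: the two runs' COUNT laws of keyed large-field blocks separate as soon as
the mean count shift exceeds the count's standard deviation (FILE J∕K bulk regime; FILE M `not_exists_hybridNE7_caricature_of_relDiscrepancy_floor`).  That mechanism needs NO
independence: for ANY two class laws and ANY real class statistic `f`, Chebyshev on the half-space above the midpoint of two centres gives a class set whose gap is
`≥ 1 − 4(V_A + V_B)∕(m_B − m_A)²`.  So a RECORD-level test of stub 2 needs only ONE-RUN first and second moments of one statistic under each run's class law plus the two-run mean gap —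
no product structure, no reading of the joint class law.  This file types that test at the generality of node U5's `HybridNE7` (arbitrary carriers `T_K`, source-dependent weights).
* §1 [folklore] `sum_filter_le_sqDev_div` ∕ `sum_filter_lt_le_sqDev_div` (Chebyshev tails on a finite weighted sum, ARBITRARY centre) · `sum_filter_le_add_sum_filter_lt`.
* §2 [folklore] ★★ `classLaw_gap_ge_one_sub_moments` (`(Σ_E b)∕Z_B − (Σ_E a)∕Z_A ≥ 1 − 4(V_A+V_B)∕(m_B−m_A)²` on `E = {f ≥ (m_A+m_B)∕2}`, `m_A < m_B`) ·
  ★★ `exists_classSet_abs_gap_ge_one_sub_moments` (symmetric form, `m_A ≠ m_B`).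
* §3 [folklore ∕ bookkeeping] ★★★ `not_exists_hybridNE7_of_frequently_momentSeparated` (frequently in `K`: some `|t| ≤ l₀`, `f`, `m_A ≠ m_B` with `8(V_A+V_B) ≤ (m_B−m_A)²` ⇒ ¬∃ dials;
  `exists_tvRadius_of_hybridNE7` BY NAME) · ★★ `not_exists_hybridNE7_of_frequently_lambda_ge` (the same in CRIT-1's letter `λ = (m_B−m_A)²∕(m_A+m_B) ≥ 8C` under Poisson-type spreads
  `V ≤ C·m`) · `momentSeparation_inhabited` (A6).

HONEST FRAMING.  [folklore] finite-sum probability (Chebyshev) ∕ [bookkeeping] over the tree's SHAPES BY NAME; the separation hypothesis is a HYPOTHESIS — whether any statistic of the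
record's keyed classes (e.g. the keyed large-field block count under `weightA₁₃ ∕ weightB₁₃`) satisfies it is UNDECIDED and would need a record reading of two one-run moments and one
two-run mean gap; NOTHING read at the record here; proves NO estimate of Bałaban's; refutes NO registered stub; nothing of Bałaban's asserted or instantiated.  NE7 ∕ NE7b ∕ NE7c NOT PRINTED
for `d = 4`, NOT proved; N19 ∕ N20 ∕ N21 NOT discharged; K3⁸ (27366, v6 b4e55110ab73e679) ∕ aside K3⁷ OPEN, no stub claimed; counts unmoved (typed 28∕28 · discharged 5∕27); no count
claim.  One finite `𝕋⁴` programme at fixed `ε`, Bałaban AS PRINTED; the YM mass gap (Clay) is NOT proved by any of this — R4 closes the conditional finite-𝕋⁴ rung `BalabanLadder.UV` only;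
NOT ℝ⁴, NOT OS.  No decl carries a cite tag.
-/

set_option autoImplicit false

noncomputable section

open Finset Filter Topology
open Literature.MathematicalPhysics.QuantumFieldTheory.Balaban1983to89.T4MatchingAssembly (HybridNE7)
open Summit.QuantumFields.YangMills.BalabanUVNodes.N20HybridClassLawCharacterisation (exists_tvRadius_of_hybridNE7)

namespace Summit.QuantumFields.YangMills.BalabanUVNodes.N20ClassLawSeparationFromMoments

/-! ## §1 Chebyshev on a finite weighted sum, with an ARBITRARY centre [folklore] -/

section Chebyshev

variable {ι : Type*} (T : Finset ι) (w f : ι → ℝ)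

/-- **UPPER-TAIL CHEBYSHEV** [folklore]: weights `w ≥ 0` on `T`, any centre `m` and any level `c > m`:
`Σ_{τ ∈ T, c ≤ f τ} w τ ≤ (Σ_T w·(f − m)²) ∕ (c − m)²` (on the tail `(f − m)² ≥ (c − m)²`; no normalisation, no «`m` is the mean» needed). -/
theorem sum_filter_le_sqDev_div (hw : ∀ τ ∈ T, 0 ≤ w τ) {m c : ℝ} (hmc : m < c) :
    ∑ τ ∈ T.filter (fun τ => c ≤ f τ), w τ ≤ (∑ τ ∈ T, w τ * (f τ - m) ^ 2) / (c - m) ^ 2 := by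
  have hcm : 0 < (c - m) ^ 2 := by positivity
  rw [le_div_iff₀ hcm]
  calc (∑ τ ∈ T.filter (fun τ => c ≤ f τ), w τ) * (c - m) ^ 2 = ∑ τ ∈ T.filter (fun τ => c ≤ f τ), w τ * (c - m) ^ 2 := by rw [Finset.sum_mul]
    _ ≤ ∑ τ ∈ T.filter (fun τ => c ≤ f τ), w τ * (f τ - m) ^ 2 := Finset.sum_le_sum fun τ hτ => by
        obtain ⟨hτT, hτc⟩ := Finset.mem_filter.1 hτ
        exact mul_le_mul_of_nonneg_left (pow_le_pow_left₀ (by linarith) (by linarith) 2) (hw τ hτT)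
    _ ≤ ∑ τ ∈ T, w τ * (f τ - m) ^ 2 := Finset.sum_le_sum_of_subset_of_nonneg (Finset.filter_subset _ _) fun τ hτ _ => mul_nonneg (hw τ hτ) (sq_nonneg _)

/-- **LOWER-TAIL CHEBYSHEV** [folklore]: `c < m` ⇒ `Σ_{τ ∈ T, f τ < c} w τ ≤ (Σ_T w·(f − m)²) ∕ (m − c)²`. -/
theorem sum_filter_lt_le_sqDev_div (hw : ∀ τ ∈ T, 0 ≤ w τ) {m c : ℝ} (hcm : c < m) :
    ∑ τ ∈ T.filter (fun τ => f τ < c), w τ ≤ (∑ τ ∈ T, w τ * (f τ - m) ^ 2) / (m - c) ^ 2 := by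
  have hmc : 0 < (m - c) ^ 2 := by positivity
  rw [le_div_iff₀ hmc]
  calc (∑ τ ∈ T.filter (fun τ => f τ < c), w τ) * (m - c) ^ 2 = ∑ τ ∈ T.filter (fun τ => f τ < c), w τ * (m - c) ^ 2 := by rw [Finset.sum_mul]
    _ ≤ ∑ τ ∈ T.filter (fun τ => f τ < c), w τ * (f τ - m) ^ 2 := Finset.sum_le_sum fun τ hτ => by
        obtain ⟨hτT, hτc⟩ := Finset.mem_filter.1 hτ
        have : (m - c) ^ 2 ≤ (f τ - m) ^ 2 := by nlinarith
        exact mul_le_mul_of_nonneg_left this (hw τ hτT)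
    _ ≤ ∑ τ ∈ T, w τ * (f τ - m) ^ 2 := Finset.sum_le_sum_of_subset_of_nonneg (Finset.filter_subset _ _) fun τ hτ _ => mul_nonneg (hw τ hτ) (sq_nonneg _)

/-- The upper tail and the strict lower tail partition the total weight. [folklore] -/
theorem sum_filter_le_add_sum_filter_lt (c : ℝ) :
    ∑ τ ∈ T.filter (fun τ => c ≤ f τ), w τ + ∑ τ ∈ T.filter (fun τ => f τ < c), w τ = ∑ τ ∈ T, w τ := by
  rw [← Finset.sum_filter_add_sum_filter_not T (fun τ => c ≤ f τ) w]
  congr 2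
  ext τ; simp [not_le]

end Chebyshev

/-! ## §2 Two class laws: a moment gap beyond the spreads SEPARATES them on the half-space above the midpoint [folklore] -/

section TwoLaws

variable {ι : Type*} (T : Finset ι) (a b f : ι → ℝ)

/-- ★★ **LAW SEPARATION FROM TWO MOMENTS OF ONE STATISTIC** [folklore]: non-negative class weights `a, b` on `T` with positive totals `Z_A, Z_B`, ANY statistic `f`, ANY centres
`m_A < m_B` with squared spreads `V_A = Σ_T (a∕Z_A)(f − m_A)²`, `V_B = Σ_T (b∕Z_B)(f − m_B)²`; then on the class set `E = {f ≥ (m_A + m_B)∕2}`: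
`(Σ_E b)∕Z_B − (Σ_E a)∕Z_A ≥ 1 − 4(V_A + V_B)∕(m_B − m_A)²` — a mean gap of `√8` combined spreads already separates the normalised laws by `½`, NO independence or product structure. -/
theorem classLaw_gap_ge_one_sub_moments (ha : ∀ τ ∈ T, 0 ≤ a τ) (hb : ∀ τ ∈ T, 0 ≤ b τ) (hZA : 0 < ∑ τ ∈ T, a τ) (hZB : 0 < ∑ τ ∈ T, b τ)
    {mA mB : ℝ} (hm : mA < mB) :
    1 - 4 * ((∑ τ ∈ T, a τ / (∑ σ ∈ T, a σ) * (f τ - mA) ^ 2) + (∑ τ ∈ T, b τ / (∑ σ ∈ T, b σ) * (f τ - mB) ^ 2)) / (mB - mA) ^ 2 ≤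
      (∑ τ ∈ T.filter (fun τ => (mA + mB) / 2 ≤ f τ), b τ) / (∑ τ ∈ T, b τ) - (∑ τ ∈ T.filter (fun τ => (mA + mB) / 2 ≤ f τ), a τ) / (∑ τ ∈ T, a τ) := by
  set c := (mA + mB) / 2 with hc
  set ZA := ∑ τ ∈ T, a τ with hZA_def
  set ZB := ∑ τ ∈ T, b τ with hZB_def
  have hpa : ∀ τ ∈ T, 0 ≤ a τ / ZA := fun τ hτ => div_nonneg (ha τ hτ) hZA.le
  have hpb : ∀ τ ∈ T, 0 ≤ b τ / ZB := fun τ hτ => div_nonneg (hb τ hτ) hZB.le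
  -- run A: upper tail ≤ V_A/(c − m_A)² = 4V_A/Δ²
  have hA := sum_filter_le_sqDev_div T (fun τ => a τ / ZA) f hpa (show mA < c by rw [hc]; linarith)
  -- run B: lower tail ≤ V_B/(m_B − c)² = 4V_B/Δ², upper tail = 1 − lower tail
  have hB := sum_filter_lt_le_sqDev_div T (fun τ => b τ / ZB) f hpb (show c < mB by rw [hc]; linarith)
  have htotB : ∑ τ ∈ T.filter (fun τ => c ≤ f τ), b τ / ZB + ∑ τ ∈ T.filter (fun τ => f τ < c), b τ / ZB = 1 := by
    rw [sum_filter_le_add_sum_filter_lt, ← Finset.sum_div, div_self hZB.ne']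
  have hcA : (c - mA) ^ 2 = (mB - mA) ^ 2 / 4 := by rw [hc]; ring
  have hcB : (mB - c) ^ 2 = (mB - mA) ^ 2 / 4 := by rw [hc]; ring
  rw [hcA] at hA; rw [hcB] at hB
  have hΔ : 0 < (mB - mA) ^ 2 := pow_pos (by linarith) 2
  rw [Finset.sum_div, Finset.sum_div]
  have e1 : ∀ V : ℝ, V / ((mB - mA) ^ 2 / 4) = 4 * V / (mB - mA) ^ 2 := fun V => by field_simp
  rw [e1] at hA hB
  have : 4 * ((∑ τ ∈ T, a τ / ZA * (f τ - mA) ^ 2) + ∑ τ ∈ T, b τ / ZB * (f τ - mB) ^ 2) / (mB - mA) ^ 2 =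
      4 * (∑ τ ∈ T, a τ / ZA * (f τ - mA) ^ 2) / (mB - mA) ^ 2 + 4 * (∑ τ ∈ T, b τ / ZB * (f τ - mB) ^ 2) / (mB - mA) ^ 2 := by ring
  rw [this]
  linarith

/-- ★★ **SYMMETRIC FORM**: for centres `m_A ≠ m_B` there is a class set `E ⊆ T` with `|(Σ_E a)∕Z_A − (Σ_E b)∕Z_B| ≥ 1 − 4(V_A + V_B)∕(m_B − m_A)²`. [folklore] -/
theorem exists_classSet_abs_gap_ge_one_sub_moments (ha : ∀ τ ∈ T, 0 ≤ a τ) (hb : ∀ τ ∈ T, 0 ≤ b τ) (hZA : 0 < ∑ τ ∈ T, a τ) (hZB : 0 < ∑ τ ∈ T, b τ)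
    {mA mB : ℝ} (hm : mA ≠ mB) :
    ∃ E, E ⊆ T ∧ 1 - 4 * ((∑ τ ∈ T, a τ / (∑ σ ∈ T, a σ) * (f τ - mA) ^ 2) + (∑ τ ∈ T, b τ / (∑ σ ∈ T, b σ) * (f τ - mB) ^ 2)) / (mB - mA) ^ 2 ≤
      |(∑ τ ∈ E, a τ) / (∑ τ ∈ T, a τ) - (∑ τ ∈ E, b τ) / (∑ τ ∈ T, b τ)| := by
  rcases lt_or_gt_of_ne hm with h | h
  · refine ⟨T.filter (fun τ => (mA + mB) / 2 ≤ f τ), Finset.filter_subset _ _, ?_⟩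
    have := classLaw_gap_ge_one_sub_moments T a b f ha hb hZA hZB h
    rw [abs_sub_comm]
    exact this.trans (le_abs_self _)
  · refine ⟨T.filter (fun τ => (mB + mA) / 2 ≤ f τ), Finset.filter_subset _ _, ?_⟩
    have := classLaw_gap_ge_one_sub_moments T b a f hb ha hZB hZA h
    rw [show (mA - mB) ^ 2 = (mB - mA) ^ 2 by ring, add_comm (∑ τ ∈ T, b τ / (∑ σ ∈ T, b σ) * (f τ - mB) ^ 2)] at this
    exact this.trans (le_abs_self _)

end TwoLaws

/-! ## §3 Along `K`: a moment separation of ANY class statistic, infinitely often, forbids K3 stub 2's dials (n20-w4's summable TV radius BY NAME) [folklore ∕ bookkeeping] -/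

section AlongK

variable {ι : Type*} [DecidableEq ι] {l₀ vol : ℝ} {T : ℕ → Finset ι} {A B : ℕ → ℝ → ι → ℝ}

/-- ★★★ **NO DIALS FROM TWO MOMENTS** [folklore ∕ bookkeeping]: carriers `T_K`, class weights `A, B ≥ 0` with positive totals on the source window `|t| ≤ l₀`.  Suppose that INFINITELY
OFTEN in `K` there are an admissible source value `t`, a class statistic `f` (any real function of the class — e.g. the number of keyed large-field blocks) and centres `m_A ≠ m_B`
with `8·(V_A + V_B) ≤ (m_B − m_A)²` (`V` = the normalised squared spreads about the centres).  Then NO `(Bad, W, shA, shB, Wsh, δ)` gives node U5's `HybridNE7 l₀ vol T A B …`: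
§2 exhibits class sets with gap `≥ ½` infinitely often, against dag-n20-w4's summable TV radius (`exists_tvRadius_of_hybridNE7`, p609004).  No independence, no product structure,
no reading of Bałaban's — one-run means and spreads of one statistic plus the two-run mean gap. -/
theorem not_exists_hybridNE7_of_frequently_momentSeparated
    (hA0 : ∀ (K : ℕ) (t : ℝ), |t| ≤ l₀ → ∀ τ ∈ T K, 0 ≤ A K t τ) (hB0 : ∀ (K : ℕ) (t : ℝ), |t| ≤ l₀ → ∀ τ ∈ T K, 0 ≤ B K t τ)
    (hZA : ∀ (K : ℕ) (t : ℝ), |t| ≤ l₀ → 0 < ∑ τ ∈ T K, A K t τ) (hZB : ∀ (K : ℕ) (t : ℝ), |t| ≤ l₀ → 0 < ∑ τ ∈ T K, B K t τ)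
    (hsep : ∃ᶠ K in atTop, ∃ (t : ℝ) (f : ι → ℝ) (mA mB : ℝ), |t| ≤ l₀ ∧ mA ≠ mB ∧
      8 * ((∑ τ ∈ T K, A K t τ / (∑ σ ∈ T K, A K t σ) * (f τ - mA) ^ 2) + (∑ τ ∈ T K, B K t τ / (∑ σ ∈ T K, B K t σ) * (f τ - mB) ^ 2)) ≤ (mB - mA) ^ 2) :
    ¬ ∃ (Bad : ℕ → ℝ → Finset ι) (W : ℕ → ℝ) (shA shB : ℕ → ℝ → ι → ℝ) (Wsh δ : ℕ → ℝ), HybridNE7 l₀ vol T A B Bad W shA shB Wsh δ := by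
  rintro ⟨Bad, W, shA, shB, Wsh, δ, h⟩
  obtain ⟨ρ, hρ01, hρs, hρ⟩ := exists_tvRadius_of_hybridNE7 h hZA hZB
  have hev : ∀ᶠ K in atTop, ρ K < 1 / 2 := (tendsto_order.1 hρs.tendsto_atTop_zero).2 _ (by norm_num)
  obtain ⟨K, ⟨t, f, mA, mB, ht, hm, hV⟩, hK⟩ := (hsep.and_eventually hev).exists
  obtain ⟨E, hE, hgap⟩ := exists_classSet_abs_gap_ge_one_sub_moments (T K) (A K t) (B K t) f (hA0 K t ht) (hB0 K t ht) (hZA K t ht) (hZB K t ht) hm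
  have hΔ : 0 < (mB - mA) ^ 2 := by have : mB - mA ≠ 0 := sub_ne_zero.2 hm.symm; positivity
  have hhalf : (1 : ℝ) / 2 ≤ 1 - 4 * ((∑ τ ∈ T K, A K t τ / (∑ σ ∈ T K, A K t σ) * (f τ - mA) ^ 2) +
      (∑ τ ∈ T K, B K t τ / (∑ σ ∈ T K, B K t σ) * (f τ - mB) ^ 2)) / (mB - mA) ^ 2 := by
    rw [le_sub_comm, div_le_iff₀ hΔ]
    linarith
  have hle := hρ K t ht E hE
  linarith


/-- ★★ **IN CRIT-1's λ-LETTER** [folklore ∕ bookkeeping]: if infinitely often some non-negative class statistic `f` has one-run spreads dominated by its one-run centres,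
`V_A ≤ C·m_A`, `V_B ≤ C·m_B` (Poisson-type concentration, `C > 0`), and the two-run statistic `λ = (m_B − m_A)²∕(m_A + m_B)` is `≥ 8C`, then NO dials give `HybridNE7`
(the previous theorem with `8(V_A + V_B) ≤ 8C(m_A + m_B) ≤ (m_B − m_A)²`).  On the independent-block caricature `f` = block count, `C = 1`, `λ` = CRIT-1's `λ_K` up to a factor 2. -/
theorem not_exists_hybridNE7_of_frequently_lambda_ge
    (hA0 : ∀ (K : ℕ) (t : ℝ), |t| ≤ l₀ → ∀ τ ∈ T K, 0 ≤ A K t τ) (hB0 : ∀ (K : ℕ) (t : ℝ), |t| ≤ l₀ → ∀ τ ∈ T K, 0 ≤ B K t τ)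
    (hZA : ∀ (K : ℕ) (t : ℝ), |t| ≤ l₀ → 0 < ∑ τ ∈ T K, A K t τ) (hZB : ∀ (K : ℕ) (t : ℝ), |t| ≤ l₀ → 0 < ∑ τ ∈ T K, B K t τ)
    (hsep : ∃ᶠ K in atTop, ∃ (t : ℝ) (f : ι → ℝ) (mA mB C : ℝ), |t| ≤ l₀ ∧ mA ≠ mB ∧ 0 < mA + mB ∧
      (∑ τ ∈ T K, A K t τ / (∑ σ ∈ T K, A K t σ) * (f τ - mA) ^ 2) ≤ C * mA ∧
      (∑ τ ∈ T K, B K t τ / (∑ σ ∈ T K, B K t σ) * (f τ - mB) ^ 2) ≤ C * mB ∧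
      8 * C ≤ (mB - mA) ^ 2 / (mA + mB)) :
    ¬ ∃ (Bad : ℕ → ℝ → Finset ι) (W : ℕ → ℝ) (shA shB : ℕ → ℝ → ι → ℝ) (Wsh δ : ℕ → ℝ), HybridNE7 l₀ vol T A B Bad W shA shB Wsh δ := by
  refine not_exists_hybridNE7_of_frequently_momentSeparated hA0 hB0 hZA hZB (hsep.mono fun K ⟨t, f, mA, mB, C, ht, hm, hpos, hVA, hVB, hlam⟩ => ?_)
  refine ⟨t, f, mA, mB, ht, hm, ?_⟩
  rw [le_div_iff₀ hpos] at hlam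
  linarith

/-- (A6) The separation hypothesis is inhabited, e.g. on two classes `{0, 1}` carrying run A's mass on `0` and run B's on `1`, statistic `f = id`, centres `0, 1`, zero spreads. [folklore] -/
theorem momentSeparation_inhabited :
    ∃ (T : Finset ℕ) (a b f : ℕ → ℝ) (mA mB : ℝ), (∀ τ ∈ T, 0 ≤ a τ) ∧ (∀ τ ∈ T, 0 ≤ b τ) ∧ 0 < ∑ τ ∈ T, a τ ∧ 0 < ∑ τ ∈ T, b τ ∧ mA ≠ mB ∧
      8 * ((∑ τ ∈ T, a τ / (∑ σ ∈ T, a σ) * (f τ - mA) ^ 2) + (∑ τ ∈ T, b τ / (∑ σ ∈ T, b σ) * (f τ - mB) ^ 2)) ≤ (mB - mA) ^ 2 := by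
  refine ⟨{0, 1}, fun τ => if τ = 0 then 1 else 0, fun τ => if τ = 1 then 1 else 0, fun τ => (τ : ℝ), 0, 1, ?_, ?_, ?_, ?_, by norm_num, ?_⟩
  · intro τ _; dsimp only; split_ifs <;> norm_num
  · intro τ _; dsimp only; split_ifs <;> norm_num
  · simp
  · simp
  · simp

end AlongK

end Summit.QuantumFields.YangMills.BalabanUVNodes.N20ClassLawSeparationFromMoments

end
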